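import Summits.Schanuel.Schanuel.Theses.RoyCriterion
import Literature.NumberTheory.Transcendental.RoySmallValueMain

/-!
# Route `RoyCriterion`, crux `RoySmallValueDirichletGap` (stmt-Schanuel-1050),
# line `two-sided-absorption-transfer` — vocabulary ("enemy links") and elementary facts

This is the `Defs` file of the crux line `two-sided-absorption-transfer`
(`Summits/Schanuel/Schanuel/Cruxes/RoySmallValueDirichletGap/Lines/two-sided-absorption-transfer.{md,lean}`,
idea card `…/Ideas/two-sided-absorption-transfer.md`, triage r2-1/2/3: pass; lead's reshape v2).

The crux is Roy 2013 (Mathematika 59 = arXiv:1301.0663), Theorem 1.1, with `ν` pushed down to the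
Dirichlet edge `2 + β − τ`.  Roy's proof (§7, tree: `Roy2013.roy2013_thm_1_1_holds`) extracts from
the small-value hypothesis at a non-algebraic point `γ = (ξ, η)`, for every large level `D`, an
ENEMY `Z_D`: a Galois orbit of algebraic points of `ℙ²` hugging the point `(1:γ)` and the leaf
`A_γ = {(1 : ξ+z : ηe^z)}` (Step 2, the mass inequality), of degree `≪ (D*)^{2−τ}` and height
`≪ (D*)^{1+β−τ}` (Step 3), obeying at the non-absorbed level `D* < D` a Liouville-type lower bound
(Step 4); Step 5 is real algebra on these data and closes iff `δ := ν − (2+β−τ) > δ_R :=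
(τ−1)(2−τ)/(β+1−τ)`.  This file holds the vocabulary in which the line re-exposes these data:

* `SmallValueHyp` — the verbatim hypothesis of the crux (`roySmallValueDirichletGap_iff`, `Iff.rfl`);
* `leafCloseness ξ η T α = max{T·log dist(ᾱ,(1:γ)), log dist(ᾱ,A_γ)}` on the sup-normalised
  representative (tree `Roy2013.pdist/adist/supNormalise`; VERBATIM the summand of the tree's Step-2
  and Step-4 inequalities `LevelPkg.step2_level`, `ZeroConfigK.step4_orbit`), `IsNear` (Roy's set `𝒰`);
* the LINK CURRENCY (polynomial-free, Roy's own: a 0-cycle with its degree and height): a link at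
  level `D` is a finite set `P ⊂ ℂ³` of algebraic points in the chart `x₀ ≠ 0` (the complex points of
  `Z_D`), a height parameter `h ≥ 0` for which LIOUVILLE'S INEQUALITY (Roy's Prop. 2.4) holds on `P`
  for every integer form, and a level `1 ≤ D* < D`, with: `#P ≤ C (D*)^{2−τ}`, `h ≤ C (D*)^{1+β−τ}`
  (Step 3), the mass inequality at depth `T = ⌊D^τ⌋` (Step 2) and the Step-4 inequality at depth
  `T* = ⌊(D*)^τ⌋` for every subset of the near points (`IsLink`, `HasLinks`); absorption of the integer
  points of Roy's body `𝒞_{D'}` (`Absorbs`, `HasAbsorbedLinks`); Roy's Step-1 forms as a standing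
  property of the point (`RichBodies`); and the line's open residual `TangentialTowerEmptiness`
  (held by the lead; ≥ the crux's open content for `τ < 3/2`);
* the ORBIT CURRENCY (`orbitHeight`, `IsOrbitLink`, `HasOrbitLinks`): the same clauses on the tree's
  own objects (`Roy2013.ZeroConfigK` over the normal number field `Roy2013.closureField S`, orbit
  `Z.orb j₀`, `h(O) = ∑_{j∈O} h_K(rep j)/[K:ℚ]`) — the output type of Roy's Steps 1–4 as formalised in
  `RoySmallValueMain.lean`, from which the link currency is reached by `Finset.image Z.α`;
* elementary facts: monotonicity of `IsLink` in `C`, and Roy's Step 5 first half run on a link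
  (`IsLink.combined` = the tree's partition lemma `le_ratio_add_one_mul` on the mass and Step-4
  clauses; `IsLink.rpow_Ds_le` = `Roy2013.endgame_step` (ii): `(D*)^{τ−1} ≤ 3C² D^{τ−1−δ}` for `C ≥ 1`).

Registered stubs of the skeleton (statements live in the skeleton; proofs land as
`Theorems/RoyCriterionRoySmallValueDirichletGapStub<Name>.lean --supports stmt-Schanuel-1050`):
`stub_enemyOrbits` (SmallValueHyp ⇒ HasOrbitLinks; Roy Steps 1–4), `stub_linksOfOrbits`
(HasOrbitLinks ⇒ HasLinks), `stub_richBodies` (SmallValueHyp ⇒ RichBodies; Roy Step 1),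
`stub_twoSidedAbsorption`, `stub_royRegime` (δ > δ_R ⇒ ¬HasLinks; Roy Step 5),
`stub_tangentialTowerEmptiness` (OPEN).

References: D. Roy, *A small value estimate for 𝔾ₐ × 𝔾ₘ*, Mathematika 59 (2013) 333–363
(arXiv:1301.0663), Theorem 1.1, Props 2.3, 2.4, 4.2, §7 Steps 1–5.
-/

-- `Summit.Schanuel.Schanuel.…` is the mandated layout of this single-problem summit (CONVENTIONS §1).
set_option linter.dupNamespace false

noncomputable section

namespace Summit.Schanuel.Schanuel.Theorems.RoyLinks

open Filter MvPolynomial Finset Height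
open Literature.NumberTheory.Transcendental
open Literature.NumberTheory.Transcendental.Roy2013
open Summit.Schanuel.Schanuel.Theses.RoyCriterion (RoySmallValueDirichletGap)

/-! ## The hypothesis of the crux -/

/-- The small-value hypothesis of the crux at `(ξ, η)` with exponents `(β, τ, ν)`: for every large
`D` a non-zero `P ∈ ℤ[X₁,X₂]` of degree `≤ D`, height `≤ e^{D^β}`, with `|𝒟₁ⁱP(ξ,η)| ≤ e^{−D^ν}` for
`i < 3⌊D^τ⌋`.  Verbatim the sub-formula of `RoySmallValueDirichletGap`.
[cite: Roy2013, Theorem 1.1 (hypothesis)] -/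
def SmallValueHyp (ξ η : ℂ) (β τ ν : ℝ) : Prop :=
  ∀ᶠ D : ℕ in atTop, ∃ P : MvPolynomial (Fin 2) ℤ, P ≠ 0 ∧ P.totalDegree ≤ D ∧
    (mvPolyHeight P : ℝ) ≤ Real.exp ((D : ℝ) ^ β) ∧
    ∀ i : ℕ, i < 3 * ⌊(D : ℝ) ^ τ⌋₊ →
      ‖MvPolynomial.aeval ![ξ, η] (royD^[i] P)‖ ≤ Real.exp (-(D : ℝ) ^ ν)

/-- READ-BACK: the crux verbatim in terms of `SmallValueHyp`. -/
theorem roySmallValueDirichletGap_iff : RoySmallValueDirichletGap ↔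
    ∀ (ξ η : ℂ), η ≠ 0 → ∀ (β τ ν : ℝ), 1 ≤ τ → τ < 2 → τ < β → 2 + β - τ < ν →
      SmallValueHyp ξ η β τ ν → IsAlgebraic ℚ ξ ∧ IsAlgebraic ℚ η := Iff.rfl

/-! ## Closeness to the point and to the leaf -/

/-- **Roy's closeness of a point to `(1:γ)` and to the leaf `A_γ` at depth `T`**:
`max{T·log dist(ᾱ,(1:γ)), log dist(ᾱ, A_γ)}` on the sup-normalised representative `ᾱ`
(tree `pdist`, `adist`, `supNormalise`; the `if` is the tree's convention for `dist(ᾱ, A_γ) = 0`).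
At `T = ⌊D^τ⌋` this is VERBATIM the summand of the tree's Step-2 inequality (`LevelPkg.step2_level`)
and, with `b` the `else` branch at depth `T`, of its Step 4 (`ZeroConfigK.step4_orbit`).
[cite: Roy2013, §7, Steps 2 and 4] -/
def leafCloseness (ξ η : ℂ) (T : ℕ) (α : Fin 3 → ℂ) : ℝ :=
  max (T * Real.log (pdist ξ η (supNormalise α)))
    (if 0 < adist ξ η (supNormalise α) then Real.log (adist ξ η (supNormalise α))
      else T * Real.log (pdist ξ η (supNormalise α)))

/-- Membership in Roy's set `𝒰` of points at projective distance `≤ (2c₂)⁻¹` from `(1:γ)`.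
[cite: Roy2013, §7, Step 2 (definition of `𝒰`)] -/
def IsNear (ξ η : ℂ) (α : Fin 3 → ℂ) : Prop :=
  pdist ξ η (supNormalise α) ≤ (2 * roy_c2 ξ η)⁻¹

/-- `IsNear` is a real inequality, hence decidable (classically, as `≤` on `ℝ`); this named instance
only unfolds the definition so that `Finset.filter (IsNear ξ η)` elaborates. -/
instance IsNear.decidable (ξ η : ℂ) : DecidablePred (IsNear ξ η) :=
  fun α => inferInstanceAs (Decidable (pdist ξ η (supNormalise α) ≤ (2 * roy_c2 ξ η)⁻¹))

/-- Unfolding lemma for `IsNear`. -/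
theorem isNear_iff (ξ η : ℂ) (α : Fin 3 → ℂ) :
    IsNear ξ η α ↔ pdist ξ η (supNormalise α) ≤ (2 * roy_c2 ξ η)⁻¹ := Iff.rfl

/-- A near point has `log dist(ᾱ,(1:γ)) ≤ 0` (indeed `dist ≤ (2c₂)⁻¹ ≤ 1/2`). [cite: Roy2013, §7, Step 2] -/
theorem log_pdist_nonpos_of_isNear {ξ η : ℂ} {α : Fin 3 → ℂ} (h : IsNear ξ η α) :
    Real.log (pdist ξ η (supNormalise α)) ≤ 0 := by
  have hc := one_le_roy_c2 ξ η
  have h1 : (2 * roy_c2 ξ η)⁻¹ ≤ 1 := by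
    rw [inv_le_one_iff₀]; right; linarith
  exact Real.log_nonpos (pdist_nonneg _ _ _) (h.trans h1)

/-! ## The link currency -/

/-- **An enemy link at level `D` with constant `C`** — Roy's enemy `Z_D` as a 0-cycle: a finite set
`P ⊂ ℂ³` of representatives (the complex points of `Z_D`), a height parameter `h` and a level `D*`,
with: (chart) `p₀ ≠ 0`; (alg) all coordinates algebraic; (pos) no point is `(1:γ)`; `P ≠ ∅`;
`1 ≤ D* < D`; (size, Step 3) `#P ≤ C (D*)^{2−τ}`, `0 ≤ h ≤ C (D*)^{1+β−τ}`;
(Liouville, Prop. 2.4) for every integer form `R` of degree `D'` not vanishing at some point of `P`: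
`R` vanishes at no point of `P` and `0 ≤ D' h + ∑_{p∈P} log(|R(p)|/‖p‖^{D'})`;
(mass, Step 2) `∑_{p ∈ P ∩ 𝒰} max{T log dist(p̄,(1:γ)), log dist(p̄, A_γ)} ≤ −(D^δ/C)(D^β #P + D h)`,
`T = ⌊D^τ⌋`; (Step 4 at `D*`) for every `𝒮 ⊆ P ∩ 𝒰`,
`∑_{p∈𝒮} max{T* log dist, log dist_A} ≥ −C((D*)^β #P + D* h)`, `T* = ⌊(D*)^τ⌋`.
For a Galois orbit, `h = #P ·` (absolute logarithmic Weil height) serves (`stub_linksOfOrbits`);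
tree constants `C = max(1280, 74·2^{1+β−τ})` serve (`stub_enemyOrbits`).
[cite: Roy2013, §7, Steps 2–4 (pp. 18–19); Prop. 2.4] -/
def IsLink (C : ℝ) (ξ η : ℂ) (β τ δ : ℝ) (D : ℕ) (P : Finset (Fin 3 → ℂ)) (h : ℝ) (Ds : ℕ) : Prop :=
  (∀ p ∈ P, p 0 ≠ 0) ∧
  (∀ p ∈ P, ∀ k, IsAlgebraic ℚ (p k)) ∧
  (∀ p ∈ P, 0 < pdist ξ η (supNormalise p)) ∧
  P.Nonempty ∧ 1 ≤ Ds ∧ Ds < D ∧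
  (P.card : ℝ) ≤ C * (Ds : ℝ) ^ (2 - τ) ∧
  0 ≤ h ∧ h ≤ C * (Ds : ℝ) ^ (1 + β - τ) ∧
  (∀ (D' : ℕ) (R : MvPolynomial (Fin 3) ℤ), R.IsHomogeneous D' →
      (∃ p ∈ P, MvPolynomial.aeval p R ≠ 0) →
      (∀ p ∈ P, MvPolynomial.aeval p R ≠ 0) ∧
        0 ≤ D' * h + ∑ p ∈ P, Real.log (‖MvPolynomial.aeval p R‖ / ‖p‖ ^ D')) ∧
  (∑ p ∈ P.filter (IsNear ξ η), leafCloseness ξ η ⌊(D : ℝ) ^ τ⌋₊ p) ≤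
      -((D : ℝ) ^ δ / C * ((D : ℝ) ^ β * P.card + D * h)) ∧
  (∀ S ⊆ P.filter (IsNear ξ η),
      -(C * ((Ds : ℝ) ^ β * P.card + Ds * h)) ≤ ∑ p ∈ S, leafCloseness ξ η ⌊(Ds : ℝ) ^ τ⌋₊ p)

/-- **`γ` carries enemy links**: for some constant `C > 0`, at every large level `D` there is an
enemy link. [cite: Roy2013, §7 (the output of Steps 1–4 before Step 5)] -/
def HasLinks (ξ η : ℂ) (β τ δ : ℝ) : Prop :=
  ∃ C : ℝ, 0 < C ∧ ∀ᶠ D : ℕ in atTop,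
    ∃ (P : Finset (Fin 3 → ℂ)) (h : ℝ) (Ds : ℕ), IsLink C ξ η β τ δ D P h Ds

/-- **Absorption at level `D'`**: every INTEGER point of Roy's body
`𝒞_{D'} = {R ∈ ℂ[X]_{D'} : ‖R‖ ≤ e^{2D'^β}, |𝒟ⁱR(1,γ)| ≤ e^{−D'^ν/2} (i < ⌊D'^τ⌋)}`, `ν = 2+β−τ+δ`
(tree `royBody`), vanishes at every point of `P`.
[cite: Roy2013, §7, Step 1 (the body `𝒞_D`) and Prop. 2.3 (2.2)] -/
def Absorbs (ξ η : ℂ) (β τ δ : ℝ) (D' : ℕ) (P : Finset (Fin 3 → ℂ)) : Prop :=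
  ∀ R : MvPolynomial (Fin 3) ℤ, R.IsHomogeneous D' →
    MvPolynomial.map (Int.castRingHom ℂ) R ∈
      royBody D' ξ η (2 * (D' : ℝ) ^ β) ((D' : ℝ) ^ (2 + β - τ + δ) / 2) ⌊(D' : ℝ) ^ τ⌋₊ →
    ∀ p ∈ P, MvPolynomial.aeval p R = 0

/-- **`γ` carries TWO-SIDED ABSORBED enemy links**: links (constant `C`) that are moreover absorbed
at every level `D'` of the two-sided range `D^{1−δ/(τ−1)}/c ≤ D' ≤ c·D^{1+δ/β}` (constant `c > 0`).
This is the hypothesis of the open stub (the card's "tangential tower", with the card's lever built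
in). [cite: Roy2013, §7; this notion: card two-sided-absorption-transfer, F2/F7] -/
def HasAbsorbedLinks (ξ η : ℂ) (β τ δ : ℝ) : Prop :=
  ∃ C c : ℝ, 0 < C ∧ 0 < c ∧ ∀ᶠ D : ℕ in atTop,
    ∃ (P : Finset (Fin 3 → ℂ)) (h : ℝ) (Ds : ℕ), IsLink C ξ η β τ δ D P h Ds ∧
      ∀ D' : ℕ, (D : ℝ) ^ (1 - δ / (τ - 1)) / c ≤ D' → (D' : ℝ) ≤ c * (D : ℝ) ^ (1 + δ / β) →
        Absorbs ξ η β τ δ D' P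

/-- **Rich bodies** (Roy 2013, §7, Step 1, as a standing property of the point and the exponents):
at every large level `D` there is an integer form `P̃_D ∈ ℤ[X]_D`, not divisible by `X₀` or `X₂`,
all of whose derivatives `𝒟ʲP̃_D`, `j ≤ 2⌊D^τ⌋`, lie in Roy's body
`𝒞_D = royBody D ξ η (2D^β) (D^ν/2) ⌊D^τ⌋`, `ν = 2 + β − τ + δ`.  Under the small-value hypothesis
this is the tree's `Roy2013.mem_body_of_step1` (`P̃_D = royTilde D P_D`); recorded in the hypothesis
of the open stub so that absorption (`Absorbs`) has content: an absorbed link lies on the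
`𝒟ʲP̃_{D'}`, `j ≤ 2⌊D'^τ⌋`, at every level `D'` of its range (Roy's Prop. 6.4 budgets).
[cite: Roy2013, §7, Step 1] -/
def RichBodies (ξ η : ℂ) (β τ δ : ℝ) : Prop :=
  ∀ᶠ D : ℕ in atTop, ∃ Pt : MvPolynomial (Fin 3) ℤ,
    (MvPolynomial.map (Int.castRingHom ℂ) Pt).IsHomogeneous D ∧
    MvPolynomial.map (Int.castRingHom ℂ) Pt ≠ 0 ∧
    ¬((X 0 : MvPolynomial (Fin 3) ℂ) ∣ MvPolynomial.map (Int.castRingHom ℂ) Pt) ∧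
    ¬((X 2 : MvPolynomial (Fin 3) ℂ) ∣ MvPolynomial.map (Int.castRingHom ℂ) Pt) ∧
    ∀ j ≤ 2 * ⌊(D : ℝ) ^ τ⌋₊, MvPolynomial.map (Int.castRingHom ℂ) ((homDK ℤ)^[j] Pt) ∈
      royBody D ξ η (2 * (D : ℝ) ^ β) ((D : ℝ) ^ (2 + β - τ + δ) / 2) ⌊(D : ℝ) ^ τ⌋₊

/-- **TANGENTIAL TOWER EMPTINESS in the gap** (the line's open residual, transfer `C⁺` of the card):
no point `(ξ, η) ∈ ℂ × ℂˣ` outside `ℚ̄²` with rich bodies carries two-sided absorbed enemy links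
with exponents `1 < τ < 2`, `β > τ`, `0 < δ ≤ δ_R = (τ−1)(2−τ)/(β+1−τ)`.  ν-free, pair-free; the
hypothesis polynomials of the crux enter only through `RichBodies` (existence of the Step-1 forms at
each level, not their values); stronger than the crux's open content (via the registered stubs).  OPEN —
this is NOT a result in print but the line's residual claim (Roy 2013, §7 Step 5 leaves exactly the
regime `δ ≤ δ_R` un-excluded; idea card two-sided-absorption-transfer, Transfer/F7); it is stated here,
problem-side, only so that the registered stub `stub_tangentialTowerEmptiness` has a name. -/
def TangentialTowerEmptiness : Prop :=
  ∀ (ξ η : ℂ), η ≠ 0 → ∀ (β τ δ : ℝ), 1 < τ → τ < 2 → τ < β → 0 < δ →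
    δ ≤ (τ - 1) * (2 - τ) / (β + 1 - τ) →
    RichBodies ξ η β τ δ → HasAbsorbedLinks ξ η β τ δ → IsAlgebraic ℚ ξ ∧ IsAlgebraic ℚ η

/-! ## The orbit currency (the tree's objects) -/

/-- **The height of an orbit** `h(O) = ∑_{j∈O} h_K(rep j) / [K:ℚ]` of a configuration of zeros over
the number field `K` (`h_K` = Mathlib's relative logarithmic Weil height `Height.logHeight`).
[cite: Roy2013, §2 (height of a 0-cycle); §7, Step 3] -/
def orbitHeight {K : IntermediateField ℚ ℂ} [NumberField K] {ι : Type*} [Fintype ι] [DecidableEq ι]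
    (Z : ZeroConfigK K ι) (j₀ : ι) : ℝ :=
  (∑ j ∈ Z.orb j₀, logHeight (Z.rep j)) / Module.finrank ℚ K

/-- **An enemy link in the orbit currency**: the clauses of `IsLink` (chart, pos, levels, size, mass,
Step 4) for the orbit `O = Z.orb j₀` of a configuration of zeros `Z` over a number field, with
`#P ↦ #O` and `h ↦ h(O) = orbitHeight Z j₀` (algebraicity and Liouville are then automatic:
`ZeroConfigK.orbit_liouville_log'`).  This is exactly what `RoySmallValueMain.lean` hands to
`Roy2013.endgame`, one level at a time. [cite: Roy2013, §7, Steps 2–4] -/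
def IsOrbitLink (C : ℝ) (ξ η : ℂ) (β τ δ : ℝ) (D : ℕ) {K : IntermediateField ℚ ℂ} [NumberField K]
    {ι : Type*} [Fintype ι] [DecidableEq ι] (Z : ZeroConfigK K ι) (j₀ : ι) (Ds : ℕ) : Prop :=
  (∀ j ∈ Z.orb j₀, Z.α j 0 ≠ 0) ∧
  (∀ j ∈ Z.orb j₀, 0 < pdist ξ η (supNormalise (Z.α j))) ∧
  1 ≤ Ds ∧ Ds < D ∧
  ((Z.orb j₀).card : ℝ) ≤ C * (Ds : ℝ) ^ (2 - τ) ∧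
  orbitHeight Z j₀ ≤ C * (Ds : ℝ) ^ (1 + β - τ) ∧
  (∑ j ∈ (Z.orb j₀).filter (fun j => IsNear ξ η (Z.α j)), leafCloseness ξ η ⌊(D : ℝ) ^ τ⌋₊ (Z.α j)) ≤
      -((D : ℝ) ^ δ / C * ((D : ℝ) ^ β * (Z.orb j₀).card + D * orbitHeight Z j₀)) ∧
  (∀ S ⊆ (Z.orb j₀).filter (fun j => IsNear ξ η (Z.α j)),
      -(C * ((Ds : ℝ) ^ β * (Z.orb j₀).card + Ds * orbitHeight Z j₀)) ≤
        ∑ j ∈ S, leafCloseness ξ η ⌊(Ds : ℝ) ^ τ⌋₊ (Z.α j))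

/-- **`γ` carries enemy links in the orbit currency**: for some `C > 0`, at every large level `D`
there are a finite set `S` of algebraic numbers, a configuration of zeros `Z` over the normal number
field `closureField S` indexed by `Fin m`, an index `j₀` and a level `D*` forming an orbit link.
[cite: Roy2013, §7, Steps 1–4] -/
def HasOrbitLinks (ξ η : ℂ) (β τ δ : ℝ) : Prop :=
  ∃ C : ℝ, 0 < C ∧ ∀ᶠ D : ℕ in atTop,
    ∃ (S : Finset ℂ) (m : ℕ) (Z : ZeroConfigK (closureField S) (Fin m)) (j₀ : Fin m) (Ds : ℕ),
      IsOrbitLink C ξ η β τ δ D Z j₀ Ds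

/-! ## Elementary facts about links -/

namespace IsLink

variable {C : ℝ} {ξ η : ℂ} {β τ δ : ℝ} {D : ℕ} {P : Finset (Fin 3 → ℂ)} {h : ℝ} {Ds : ℕ}

/-- A link has at least one point. -/
theorem one_le_card (hL : IsLink C ξ η β τ δ D P h Ds) : (1 : ℝ) ≤ P.card := by
  exact_mod_cast hL.2.2.2.1.card_pos

/-- The constant of a link is positive (the size clause and `P ≠ ∅`). -/
theorem const_pos (hL : IsLink C ξ η β τ δ D P h Ds) : 0 < C := by
  have h1 := hL.one_le_card
  have h2 := hL.2.2.2.2.2.2.1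
  have hDs : (0 : ℝ) < (Ds : ℝ) ^ (2 - τ) := by
    have : (1 : ℝ) ≤ Ds := by exact_mod_cast hL.2.2.2.2.1
    exact Real.rpow_pos_of_pos (by linarith) _
  by_contra hC
  push Not at hC
  have : C * (Ds : ℝ) ^ (2 - τ) ≤ 0 := mul_nonpos_of_nonpos_of_nonneg hC hDs.le
  linarith

/-- **Monotonicity in the constant**: a link with constant `C` is a link with any `C' ≥ C`. -/
theorem mono (hL : IsLink C ξ η β τ δ D P h Ds) {C' : ℝ} (hCC' : C ≤ C') :
    IsLink C' ξ η β τ δ D P h Ds := by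
  obtain ⟨hch, halg, hpos, hne, hDs1, hDsD, hcard, hh0, hh, hLiou, hmass, hstep4⟩ := hL
  have hC : 0 < C := IsLink.const_pos ⟨hch, halg, hpos, hne, hDs1, hDsD, hcard, hh0, hh, hLiou, hmass, hstep4⟩
  have hx : (0 : ℝ) ≤ Ds := Nat.cast_nonneg _
  have hxD : (0 : ℝ) ≤ D := Nat.cast_nonneg _
  have hd0 : (0 : ℝ) ≤ P.card := Nat.cast_nonneg _
  refine ⟨hch, halg, hpos, hne, hDs1, hDsD, ?_, hh0, ?_, hLiou, ?_, ?_⟩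
  · exact hcard.trans (mul_le_mul_of_nonneg_right hCC' (Real.rpow_nonneg hx _))
  · exact hh.trans (mul_le_mul_of_nonneg_right hCC' (Real.rpow_nonneg hx _))
  · refine hmass.trans ?_
    have hbr : 0 ≤ (D : ℝ) ^ β * P.card + D * h :=
      add_nonneg (mul_nonneg (Real.rpow_nonneg hxD _) hd0) (mul_nonneg hxD hh0)
    have hδ0 : 0 ≤ (D : ℝ) ^ δ := Real.rpow_nonneg hxD _
    have : (D : ℝ) ^ δ / C' * ((D : ℝ) ^ β * P.card + D * h) ≤
        (D : ℝ) ^ δ / C * ((D : ℝ) ^ β * P.card + D * h) :=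
      mul_le_mul_of_nonneg_right (div_le_div_of_nonneg_left hδ0 hC hCC') hbr
    linarith
  · intro S hS
    refine le_trans ?_ (hstep4 S hS)
    have hbr : 0 ≤ (Ds : ℝ) ^ β * P.card + Ds * h :=
      add_nonneg (mul_nonneg (Real.rpow_nonneg hx _) hd0) (mul_nonneg hx hh0)
    have := mul_le_mul_of_nonneg_right hCC' hbr
    linarith

/-- **Roy 2013, §7, Step 5, "combining these three inequalities"**, run on a link: the mass clause
(depth `T = ⌊D^τ⌋`) and the Step-4 clause (depth `T* = ⌊(D*)^τ⌋`, all subsets of `P ∩ 𝒰`) give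
`(D^δ/C)(D^β #P + D h) ≤ (T/T* + 1) · C((D*)^β #P + D* h)` (the tree's partition lemma
`Roy2013.le_ratio_add_one_mul` with `aₚ = log dist(p̄,(1:γ))`, `bₚ` = the second coordinate of
`leafCloseness` at depth `T*`).  [cite: Roy2013, §7, Step 5 (first display)] -/
theorem combined (hL : IsLink C ξ η β τ δ D P h Ds) (hτ : 0 ≤ τ) :
    (D : ℝ) ^ δ / C * ((D : ℝ) ^ β * P.card + D * h) ≤
      ((⌊(D : ℝ) ^ τ⌋₊ : ℝ) / ⌊(Ds : ℝ) ^ τ⌋₊ + 1) * (C * ((Ds : ℝ) ^ β * P.card + Ds * h)) := by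
  obtain ⟨-, -, -, -, hDs1, hDsD, -, -, -, -, hmass, hstep4⟩ := hL
  set U := P.filter (IsNear ξ η) with hU
  set T : ℕ := ⌊(D : ℝ) ^ τ⌋₊ with hT
  set Ts : ℕ := ⌊(Ds : ℝ) ^ τ⌋₊ with hTs
  -- `T* ≥ 1` and `T* ≤ T`
  have hTs1 : 1 ≤ Ts := one_le_natFloor_rpow hDs1 hτ
  have hTsT : Ts ≤ T := by
    apply Nat.floor_le_floor
    exact Real.rpow_le_rpow (Nat.cast_nonneg _) (by exact_mod_cast hDsD.le) hτ
  -- the two coordinates (`b` = the second coordinate of `leafCloseness` at depth `T`)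
  set a : (Fin 3 → ℂ) → ℝ := fun p => Real.log (pdist ξ η (supNormalise p)) with ha
  set b : (Fin 3 → ℂ) → ℝ := fun p =>
    if 0 < adist ξ η (supNormalise p) then Real.log (adist ξ η (supNormalise p))
    else T * Real.log (pdist ξ η (supNormalise p)) with hb
  -- depth `T`: `leafCloseness T p = max (T aₚ) bₚ` literally
  have hT_eq : ∀ p, leafCloseness ξ η T p = max ((T : ℝ) * a p) (b p) := fun p => rfl
  -- depth `T*`: `leafCloseness T* p = max (T* aₚ) bₚ` on near points (`aₚ ≤ 0`, `T* ≤ T`)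
  have hTs_eq : ∀ p ∈ U, leafCloseness ξ η Ts p = max ((Ts : ℝ) * a p) (b p) := by
    intro p hp
    have hnear : IsNear ξ η p := (mem_filter.mp hp).2
    have ha0 : a p ≤ 0 := log_pdist_nonpos_of_isNear hnear
    simp only [leafCloseness, hb, ha]
    split_ifs with hq
    · rfl
    · have hTT : (Ts : ℝ) ≤ T := by exact_mod_cast hTsT
      have h1 : (T : ℝ) * Real.log (pdist ξ η (supNormalise p)) ≤
          Ts * Real.log (pdist ξ η (supNormalise p)) := by
        have := mul_le_mul_of_nonpos_right hTT ha0
        simpa [ha] using this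
      rw [max_self, max_eq_left h1]
  have h2 : ∑ p ∈ U, max ((T : ℝ) * a p) (b p) ≤
      -((D : ℝ) ^ δ / C * ((D : ℝ) ^ β * P.card + D * h)) := by
    calc ∑ p ∈ U, max ((T : ℝ) * a p) (b p) = ∑ p ∈ U, leafCloseness ξ η T p :=
          sum_congr rfl fun p _ => (hT_eq p).symm
      _ ≤ _ := hmass
  have h4 : ∀ S ⊆ U, -(C * ((Ds : ℝ) ^ β * P.card + Ds * h)) ≤
      ∑ p ∈ S, max ((Ts : ℝ) * a p) (b p) := by
    intro S hS
    calc -(C * ((Ds : ℝ) ^ β * P.card + Ds * h)) ≤ ∑ p ∈ S, leafCloseness ξ η Ts p := hstep4 S hS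
      _ = ∑ p ∈ S, max ((Ts : ℝ) * a p) (b p) := sum_congr rfl fun p hp => hTs_eq p (hS hp)
  exact le_ratio_add_one_mul U a b (Nat.cast_nonneg T) (by exact_mod_cast hTs1) h2 h4

/-- **Roy 2013, §7, Step 5 (ii), run on a link**: for `1 ≤ τ ≤ β`, `C ≥ 1` and `D^δ ≥ 6C³`,
`(D*)^{τ−1} ≤ 3C² · D^{τ−1−δ}` — the tree's `Roy2013.endgame_step` (first conclusion) on
`IsLink.combined`, with `κ = 1/C²`, `A = C`, `A₃ = C²`, `d = #P`, `h(Z) = C·h`.  In particular a link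
of level `D` is born at a level `D* ≤ (3C²)^{1/(τ−1)} D^{1−δ/(τ−1)}` (for `τ > 1`; first raise the
constant to `max C 1` by `IsLink.mono`).  [cite: Roy2013, §7, Step 5] -/
theorem rpow_Ds_le (hL : IsLink C ξ η β τ δ D P h Ds) (hτ1 : 1 ≤ τ) (hτβ : τ ≤ β) (hC1 : 1 ≤ C)
    (hlarge : 6 * C ^ 3 ≤ (D : ℝ) ^ δ) :
    (Ds : ℝ) ^ (τ - 1) ≤ 3 * C ^ 2 * (D : ℝ) ^ (τ - 1 - δ) := by
  have hC : 0 < C := hL.const_pos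
  have hcomb := hL.combined (by linarith)
  obtain ⟨-, -, -, hne, hDs1, hDsD, -, hh0, hh, -, -, -⟩ := hL
  have hd1 : (1 : ℝ) ≤ P.card := by exact_mod_cast hne.card_pos
  have hd0 : (0 : ℝ) ≤ P.card := by linarith
  have hDs1r : (1 : ℝ) ≤ Ds := by exact_mod_cast hDs1
  have hDsDr : (Ds : ℝ) ≤ D := by exact_mod_cast hDsD.le
  have hD1 : (1 : ℝ) ≤ D := hDs1r.trans hDsDr
  have hτ0 : 0 ≤ τ := by linarith
  have hT : ((⌊(D : ℝ) ^ τ⌋₊ : ℕ) : ℝ) ≤ (D : ℝ) ^ τ := natFloor_rpow_le D τ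
  have hTs : (0 : ℝ) < (⌊(Ds : ℝ) ^ τ⌋₊ : ℕ) := by exact_mod_cast one_le_natFloor_rpow hDs1 hτ0
  have hTs2 : (Ds : ℝ) ^ τ ≤ 2 * (⌊(Ds : ℝ) ^ τ⌋₊ : ℕ) := rpow_le_two_mul_natFloor hDs1 hτ0
  have hκ : (0 : ℝ) < 1 / C ^ 2 := by positivity
  have hDδ : (0 : ℝ) ≤ (D : ℝ) ^ δ := Real.rpow_nonneg (by linarith) _
  have hDβ : (0 : ℝ) ≤ (D : ℝ) ^ β := Real.rpow_nonneg (by linarith) _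
  have hineq : 1 / C ^ 2 * (D : ℝ) ^ δ * ((D : ℝ) ^ β * P.card + D * (C * h)) ≤
      ((⌊(D : ℝ) ^ τ⌋₊ : ℝ) / ⌊(Ds : ℝ) ^ τ⌋₊ + 1) * (C * (Ds : ℝ) ^ β * P.card + Ds * (C * h)) := by
    have e2 : C * (Ds : ℝ) ^ β * P.card + Ds * (C * h) = C * ((Ds : ℝ) ^ β * P.card + Ds * h) := by ring
    rw [e2]
    refine le_trans ?_ hcomb
    -- `(1/C²) D^δ (D^β d + D C h) ≤ (1/C) D^δ (D^β d + D h)` as `C ≥ 1`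
    have hinv : 1 / C ^ 2 ≤ 1 / C := by
      rw [div_le_div_iff_of_pos_left one_pos (by positivity) hC]; nlinarith
    have t1 : 1 / C ^ 2 * (D : ℝ) ^ δ * ((D : ℝ) ^ β * P.card) ≤ 1 / C * (D : ℝ) ^ δ * ((D : ℝ) ^ β * P.card) :=
      mul_le_mul_of_nonneg_right (mul_le_mul_of_nonneg_right hinv hDδ) (mul_nonneg hDβ hd0)
    have t2 : 1 / C ^ 2 * (D : ℝ) ^ δ * (D * (C * h)) = 1 / C * (D : ℝ) ^ δ * (D * h) := by
      field_simp
    have e1 : (D : ℝ) ^ δ / C * ((D : ℝ) ^ β * P.card + D * h) =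
        1 / C * (D : ℝ) ^ δ * ((D : ℝ) ^ β * P.card) + 1 / C * (D : ℝ) ^ δ * (D * h) := by ring
    rw [e1, mul_add, t2]
    linarith
  have hlarge' : 6 * C ≤ 1 / C ^ 2 * (D : ℝ) ^ δ := by
    rw [one_div, ← div_eq_inv_mul, le_div_iff₀ (by positivity)]; nlinarith
  have hstep := endgame_step (τ := τ) (β := β) (δ := δ) (κ := 1 / C ^ 2) (A := C) (A₃ := C ^ 2)
    (D := (D : ℝ)) (Ds := (Ds : ℝ)) (d := (P.card : ℝ)) (h := C * h)
    (T := ((⌊(D : ℝ) ^ τ⌋₊ : ℕ) : ℝ)) (Ts := ((⌊(Ds : ℝ) ^ τ⌋₊ : ℕ) : ℝ))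
    hτ0 hτβ hκ hD1 hDs1r hDsDr hd1 (mul_nonneg hC.le hh0)
    (by have := mul_le_mul_of_nonneg_left hh hC.le; nlinarith) (Nat.cast_nonneg _) hT hTs hTs2
    hlarge' hineq
  have e : 3 / (1 / C ^ 2) * (D : ℝ) ^ (τ - 1 - δ) = 3 * C ^ 2 * (D : ℝ) ^ (τ - 1 - δ) := by
    field_simp
  rw [← e]; exact hstep.1

end IsLink

end Summit.Schanuel.Schanuel.Theorems.RoyLinks

end
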